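import Summits.AnomalousDissipation.AnomalousDissipation.Theorems.SolenoidalFractalHomogenisationRealisedQuasiStaticCellLawOutOfPlaneDecay
import Summits.AnomalousDissipation.AnomalousDissipation.Theorems.SolenoidalFractalHomogenisationRealisedQuasiStaticCellLawInPlaneDecay
import Summits.AnomalousDissipation.AnomalousDissipation.Theorems.SolenoidalFractalHomogenisationRealisedQuasiStaticCellLawPrincipalCosetEnergy
import HarnessLib

/-!
# K2R `RealisedQuasiStaticCellLaw`, line `floquet-bloch`: ENHANCED contraction of a whole principal coset during a slot window
# (helper towards `stub_lowSectorDecay`; `--supports stmt-AnomalousDissipation-20446`)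

Summits-side helper file (everything proved; no definitions, no named facts). Composition of `outOfPlane_block_decay`,
`inPlane_block_decay` and the energy split `norm_sq_galerkinCoeffAt_eq_blocks`: on a window `[t₀, t₁] ⊆ [0, T]` in slot `j`,
for a principal coset `k_J = k₀ + J•K_j` (no zero frequency in the ball) with real unit normal `ζ` of `span(k₀, K_j)`, in-plane
frame `p_J = |k_J|⁻¹ k_J × ζ`, segment `W ∋ 0, ±1`, the diagonal hypotheses, `|p_J·p_{J+1}| ≤ 1`, `γ² = (p₀·p₁)² + (p₋₁·p₀)² > 0`
and coupling `g_j ∈ [g_lo, g_hi]` on the window, the coset energy of the Galerkin truncation contracts at the enhanced rate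
`Λ_j · min(2, γ²) · g_lo · min(g_lo, g_hi⁻¹)/80`:
`∑_{J∈W} ‖α_N(t)(k_J)‖² ≤ (5/3) e^{-rate (t - t₀)} ∑_{J∈W} ‖α_N(t₀)(k_J)‖²` (`principalCoset_decay`), uniformly in `N`
(STUB-PLAN `stub_lowSectorDecay` §3.5, «the slow modes contract by e^{-E_B} per good slot»; recipe §2).
-/

set_option linter.dupNamespace false

noncomputable section

namespace Summit.AnomalousDissipation.AnomalousDissipation.Theorems.SolenoidalFractalHomogenisation.RealisedQuasiStaticCellLaw

open Set MeasureTheory Filter Topology Function Matrix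
open scoped InnerProductSpace ComplexConjugate Matrix
open Literature.Analysis Literature.Analysis.FunctionSpaces Literature.Analysis.FunctionSpaces.Torus
open Literature.Analysis.FluidPDE Literature.Analysis.FluidPDE.LatticeShear

variable {k₀ : ℕ}

/-- **Enhanced contraction of a principal coset during a slot window** (uniform in the truncation order `N`). -/
theorem principalCoset_decay (W : LatticeWord k₀) {n : ℕ} (hn : 0 < n) {κ : ℝ} (hκ : 0 < κ)
    (ℓ : Fin 3 → ℤ) {w₀ : UnitAddTorus (Fin 3) → EuclideanSpace ℝ (Fin 3)}
    (hw₀ : FunctionSpaces.Torus.MemSobolev 1 (FunctionSpaces.EuclideanSpace.complexify ∘ w₀))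
    (hdiv : FunctionSpaces.Torus.IsWeaklyDivFree w₀) (hmean : FunctionSpaces.Torus.HasZeroMean w₀)
    (hsupp : ∀ k : Fin 3 → ℤ, ¬ ((∃ z : Fin 3 → ℤ, k = ℓ + (n:ℤ) • z) ∨ (∃ z : Fin 3 → ℤ, k = -ℓ + (n:ℤ) • z)) →
      UnitAddTorus.mFourierCoeff (FunctionSpaces.EuclideanSpace.complexify ∘ w₀) k = 0)
    {N : ℕ} (hBN : (Finset.univ.biUnion fun j : Fin k₀ =>
        ({(fun i => (W.phase j).m i * n), -(fun i => (W.phase j).m i * n)} : Finset (Fin 3 → ℤ))) ⊆ freqBall N)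
    {T t₀ t₁ : ℝ} (ht₀ : 0 ≤ t₀) (ht₁T : t₁ ≤ T) (j : Fin k₀)
    (hwin : ∀ t ∈ Icc t₀ t₁, Int.fract (t / W.period) * W.period ∈ Icc (W.start j) (W.start j + (W.phase j).τ))
    (k0 : Fin 3 → ℤ) (hk : ∀ J : ℤ, k0 + J • (fun i => (W.phase j).m i * (n : ℤ)) ∈ freqBall N →
      k0 + J • (fun i => (W.phase j).m i * (n : ℤ)) ≠ 0)
    {ζr : Fin 3 → ℝ} (hζ1 : ζr ⬝ᵥ ζr = 1) (hζ0 : ζr ⬝ᵥ (fun i => ((k0 i : ℤ) : ℝ)) = 0)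
    (hζK : ζr ⬝ᵥ (fun i => (((fun i => (W.phase j).m i * (n : ℤ)) i : ℤ) : ℝ)) = 0)
    {p : ℤ → Fin 3 → ℝ}
    (hp : ∀ J : ℤ, p J = (Real.sqrt ((fun i => (((k0 + J • (fun i => (W.phase j).m i * (n : ℤ))) i : ℤ) : ℝ)) ⬝ᵥ
        (fun i => (((k0 + J • (fun i => (W.phase j).m i * (n : ℤ))) i : ℤ) : ℝ))))⁻¹ •
        (fun i => (((k0 + J • (fun i => (W.phase j).m i * (n : ℤ))) i : ℤ) : ℝ)) ⨯₃ ζr)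
    {Wset : Finset ℤ} (hW : ∀ J : ℤ, J ∈ Wset ↔ k0 + J • (fun i => (W.phase j).m i * (n : ℤ)) ∈ freqBall N)
    (h0 : (0 : ℤ) ∈ Wset) (h1 : (1 : ℤ) ∈ Wset) (hm1 : (-1 : ℤ) ∈ Wset)
    (hs : ∀ J ∈ Wset, |p J ⬝ᵥ p (J + 1)| ≤ 1) (hγpos : 0 < (p 0 ⬝ᵥ p 1) ^ 2 + (p (-1) ⬝ᵥ p 0) ^ 2)
    (hd0 : freqNormSq k0 / freqNormSq (fun i => (W.phase j).m i * (n : ℤ)) ≤ 1)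
    (hd : ∀ J ∈ Wset, J ≠ 0 →
      1 / 2 ≤ freqNormSq (k0 + J • (fun i => (W.phase j).m i * (n : ℤ))) / freqNormSq (fun i => (W.phase j).m i * (n : ℤ)))
    (hd1 : freqNormSq (k0 + (1 : ℤ) • (fun i => (W.phase j).m i * (n : ℤ))) /
      freqNormSq (fun i => (W.phase j).m i * (n : ℤ)) ≤ 2)
    (hdm1 : freqNormSq (k0 + (-1 : ℤ) • (fun i => (W.phase j).m i * (n : ℤ))) /
      freqNormSq (fun i => (W.phase j).m i * (n : ℤ)) ≤ 2)
    {g_lo g_hi : ℝ} (hglo : 0 < g_lo) (hghi : g_lo ≤ g_hi)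
    (hg : ∀ t ∈ Ioo t₀ t₁,
      g_lo ≤ 2 * Real.pi * (∑ i, (W.phase j).e i * (k0 i : ℝ)) *
          ‖Complex.exp ((W.phase j).φ * Complex.I) *
            (1 / (2 * ((2 * Real.pi * ‖latticeVec (W.phase j).m‖ : ℝ) : ℂ) * Complex.I))‖ *
          ((1 / (n : ℝ)) * LatticeWord.trapezoid (W.start j) (W.phase j).τ W.ramp (Int.fract (t / W.period) * W.period)) /
        (κ * (4 * Real.pi ^ 2 * freqNormSq (fun i => (W.phase j).m i * (n : ℤ)))) ∧
      2 * Real.pi * (∑ i, (W.phase j).e i * (k0 i : ℝ)) *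
          ‖Complex.exp ((W.phase j).φ * Complex.I) *
            (1 / (2 * ((2 * Real.pi * ‖latticeVec (W.phase j).m‖ : ℝ) : ℂ) * Complex.I))‖ *
          ((1 / (n : ℝ)) * LatticeWord.trapezoid (W.start j) (W.phase j).τ W.ramp (Int.fract (t / W.period) * W.period)) /
        (κ * (4 * Real.pi ^ 2 * freqNormSq (fun i => (W.phase j).m i * (n : ℤ)))) ≤ g_hi) :
    ∀ t ∈ Icc t₀ t₁,
      ∑ J ∈ Wset, ‖(pvSetup_cell W hn hκ.le ℓ hw₀ hdiv hmean hsupp).galerkinCoeffAt N t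
          (k0 + J • (fun i => (W.phase j).m i * (n : ℤ)))‖ ^ 2 ≤
        5 / 3 * Real.exp (-(κ * (4 * Real.pi ^ 2 * freqNormSq (fun i => (W.phase j).m i * (n : ℤ))) *
            min 2 ((p 0 ⬝ᵥ p 1) ^ 2 + (p (-1) ⬝ᵥ p 0) ^ 2) * g_lo * min g_lo g_hi⁻¹ / 80) * (t - t₀)) *
          ∑ J ∈ Wset, ‖(pvSetup_cell W hn hκ.le ℓ hw₀ hdiv hmean hsupp).galerkinCoeffAt N t₀
            (k0 + J • (fun i => (W.phase j).m i * (n : ℤ)))‖ ^ 2 := by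
  intro t ht
  set ζc : EuclideanSpace ℂ (Fin 3) := WithLp.toLp 2 (Complex.ofReal ∘ ζr) with hζc
  -- complex transversality of `ζ`
  have hcast : ∀ k : Fin 3 → ℤ, ζr ⬝ᵥ (fun i => ((k i : ℤ) : ℝ)) = 0 → ∑ i, ((k i : ℤ) : ℂ) * ζc i = 0 := by
    intro k hk0
    have e : ∑ i, ((k i : ℤ) : ℂ) * ζc i = (((ζr ⬝ᵥ fun i => ((k i : ℤ) : ℝ) : ℝ)) : ℂ) := by
      rw [dotProduct]; push_cast
      refine Finset.sum_congr rfl fun i _ => ?_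
      simp [hζc, mul_comm]
    rw [e, hk0]; simp
  have hout := outOfPlane_block_decay W hn hκ ℓ hw₀ hdiv hmean hsupp hBN ht₀ ht₁T j hwin k0 (hcast k0 hζ0) (hcast _ hζK)
    hW h0 h1 hm1 hd0 hd hd1 hdm1 hglo hghi hg t ht
  have hin := inPlane_block_decay W hn hκ ℓ hw₀ hdiv hmean hsupp hBN ht₀ ht₁T j hwin k0 hk hζ1 hζ0 hζK hp hW h0 h1 hm1
    hs hγpos hd0 hd hd1 hdm1 hglo hghi hg t ht
  set hPV := pvSetup_cell W hn hκ.le ℓ hw₀ hdiv hmean hsupp with hPVdef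
  set K : Fin 3 → ℤ := fun i => (W.phase j).m i * (n : ℤ) with hK
  set Λ : ℝ := κ * (4 * Real.pi ^ 2 * freqNormSq K) with hΛ
  set γ2 : ℝ := (p 0 ⬝ᵥ p 1) ^ 2 + (p (-1) ⬝ᵥ p 0) ^ 2 with hγ2
  set m : ℝ := min g_lo g_hi⁻¹ with hm
  -- energy split on the coset
  have hsplit : ∀ τ, ∑ J ∈ Wset, ‖hPV.galerkinCoeffAt N τ (k0 + J • K)‖ ^ 2 =
      ∑ J ∈ Wset, ‖inner ℂ ζc (hPV.galerkinCoeffAt N τ (k0 + J • K))‖ ^ 2 +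
        ∑ J ∈ Wset, ‖inner ℂ (WithLp.toLp 2 (Complex.ofReal ∘ p J) : EuclideanSpace ℂ (Fin 3))
          (hPV.galerkinCoeffAt N τ (k0 + J • K))‖ ^ 2 := by
    intro τ
    rw [← Finset.sum_add_distrib]
    refine Finset.sum_congr rfl fun J hJ => ?_
    rw [hp J]
    exact norm_sq_galerkinCoeffAt_eq_blocks W hn hκ.le ℓ hw₀ hdiv hmean hsupp N τ j k0 J (hk J ((hW J).1 hJ)) hζ1 hζ0 hζK
  -- positivity of the constants and comparison of the rates
  have hKpos : 0 < freqNormSq K := by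
    have hK0 : K ≠ 0 := cellFreq_ne_zero (W.phase j) hn
    obtain ⟨i, hi⟩ : ∃ i, K i ≠ 0 := by
      by_contra h
      push Not at h
      exact hK0 (funext h)
    have hi' : (K i : ℝ) ≠ 0 := by exact_mod_cast hi
    unfold freqNormSq
    exact lt_of_lt_of_le (by positivity) (Finset.single_le_sum (fun l _ => sq_nonneg ((K l : ℝ))) (Finset.mem_univ i))
  have hΛpos : 0 < Λ := by positivity
  have hmpos : 0 < m := lt_min hglo (inv_pos.2 (hglo.trans_le hghi))
  have hs0 : 0 ≤ t - t₀ := by linarith [ht.1]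
  have hbase : 0 ≤ Λ * g_lo * m / 80 * (t - t₀) := by positivity
  have hexp_out : Real.exp (-(Λ * 2 * g_lo * m / 80) * (t - t₀)) ≤ Real.exp (-(Λ * min 2 γ2 * g_lo * m / 80) * (t - t₀)) := by
    rw [Real.exp_le_exp]
    have : min 2 γ2 ≤ 2 := min_le_left _ _
    nlinarith
  have hexp_in : Real.exp (-(Λ * γ2 * g_lo * m / 80) * (t - t₀)) ≤ Real.exp (-(Λ * min 2 γ2 * g_lo * m / 80) * (t - t₀)) := by
    rw [Real.exp_le_exp]
    have : min 2 γ2 ≤ γ2 := min_le_right _ _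
    nlinarith
  have hEout0 : 0 ≤ ∑ J ∈ Wset, ‖inner ℂ ζc (hPV.galerkinCoeffAt N t₀ (k0 + J • K))‖ ^ 2 :=
    Finset.sum_nonneg fun _ _ => by positivity
  have hEin0 : 0 ≤ ∑ J ∈ Wset, ‖inner ℂ (WithLp.toLp 2 (Complex.ofReal ∘ p J) : EuclideanSpace ℂ (Fin 3))
      (hPV.galerkinCoeffAt N t₀ (k0 + J • K))‖ ^ 2 := Finset.sum_nonneg fun _ _ => by positivity
  rw [hsplit t, hsplit t₀, mul_add]
  refine add_le_add (hout.trans ?_) (hin.trans ?_)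
  · exact mul_le_mul_of_nonneg_right (mul_le_mul_of_nonneg_left hexp_out (by norm_num)) hEout0
  · exact mul_le_mul_of_nonneg_right (mul_le_mul_of_nonneg_left hexp_in (by norm_num)) hEin0

end Summit.AnomalousDissipation.AnomalousDissipation.Theorems.SolenoidalFractalHomogenisation.RealisedQuasiStaticCellLaw

end
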